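import Mathlib.Combinatorics.SetFamily.Shadow
import Mathlib.Combinatorics.Enumerative.DoubleCounting
import Mathlib.Data.Nat.Choose.Basic
import Mathlib.Tactic.Ring
import HarnessLib

/-!
# `NoHeavyLowerTail` (crux stmt-CriticalPhenomena-4575), P3 lane (c = 2 coefficientwise threshold certificate):
# the WEIGHTED LYM LEMMA for up-sets, profile-wise, and the FLAG LEMMA of the reduction theorem

Support file (seat `prim-l12-p3`, gen 18; `--supports stmt-CriticalPhenomena-4575`).  Memo
`run/shared/lean/prim/prim-l12/FROM-prim-l12-p3-g17-REDUCTION-TO-3-COLOURINGS.md` §1 (Lemma 1.1, Lemma 1.2 = M2).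

Setting.  The c = 2 certificate programme works with generating functions of set families `F ⊆ 2^M`,
`GF(F) = Σ_{S ∈ F} r^S`, and needs inequalities COEFFICIENTWISE in the monomials `r^μ`, `μ : M → ℕ`.  The coefficient of
`r^μ` in a product `GF(F₁)·GF(F₂)` is the number of pairs `(P, S) ∈ F₁ × F₂` with `1_P + 1_S = μ`; such a pair exists only
for `μ ≤ 2`, and then `1_P + 1_S = μ` says exactly `P ∪ S = N := {μ ≥ 1}` and `P ∩ S = D := {μ = 2}`.  So a profile is a
pair of finsets `D ⊆ N` and "coefficientwise" statements are statements about pairs `(P, S)` with prescribed union and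
intersection.  In this language the file proves, for a family `𝒰` that is UPWARD CLOSED INSIDE `N`
(`A ∈ 𝒰, A ⊆ B ⊆ N ⇒ B ∈ 𝒰`; e.g. the non-faces of a simplicial complex on the ground set `N`, or any `IsUpperSet`):

* `card_level_le_card_level` (LYM for up-sets, the form needed): for `D ⊆ N` and sizes `c ≤ j` with
  `c + j = #N + #D`, `#{S ∈ 𝒰 : D ⊆ S ⊆ N, #S = c} ≤ #{S ∈ 𝒰 : D ⊆ S ⊆ N, #S = j}` — inside the cube `[D, N]` the two
  levels are complementary, and the density of an up-set on the levels of a cube is non-decreasing (`card_level_mul_le`,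
  one double-counting step; `card_level_mul_choose_le`, iterated);
* `weightedLYM_pairs` (memo Lemma 1.1, `e_c·𝒰_j − e_j·𝒰_c ∈ ℕ[r]`): the number of pairs `(P, S)` with `#P = j`, `S ∈ 𝒰`,
  `#S = c`, `P ∩ S = D`, `P ∪ S = N` is at most the number of such pairs with `#P = c`, `#S = j`;
* `flagLemma_pairs` (memo Lemma 1.2 (M2), `Θ·t̄_K − D·ε̄_K ∈ ℕ[r]` for the up-set `𝒰` of non-faces of a complex `K`):
  the number of pairs `(P, S)` with `#P ≥ 3`, `S ∈ 𝒰`, `#S = 2` (given union/intersection) is at most the number of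
  pairs with `#P ≤ 2`, `S ∈ 𝒰`, `#S ≥ 3`.

These are the two non-manifest brackets of the REDUCTION THEOREM (memo §1.3: every all-live form of the c = 2 certificate
decreases coefficientwise when a face of size ≥ 3 or a one-sided edge is added, so the open slice statements may assume
flag complexes with no common non-edge).  The polynomial identities (M1), (M2) of the memo and the generating-function
calculus itself are NOT in this file.  Nothing is asserted about the crux.
-/

namespace Summit.CriticalPhenomena.PercolationContinuityZ3.Theorems.SahiCTCWeightedLYM

open Finset

variable {α : Type*} [DecidableEq α]

/-! ### Levels of a family inside a cube `[D, N]` -/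

/-- The members of `𝒰` lying in the cube `[D, N] = {S : D ⊆ S ⊆ N}` and having exactly `k` elements. [this work] -/
def level (𝒰 : Finset (Finset α)) (D N : Finset α) (k : ℕ) : Finset (Finset α) :=
  𝒰.filter fun S => D ⊆ S ∧ S ⊆ N ∧ #S = k

omit [DecidableEq α] in
/-- Membership in `level`. [this work] -/
theorem mem_level [DecidableEq α] {𝒰 : Finset (Finset α)} {D N : Finset α} {k : ℕ} {S : Finset α} :
    S ∈ level 𝒰 D N k ↔ S ∈ 𝒰 ∧ D ⊆ S ∧ S ⊆ N ∧ #S = k := by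
  simp [level]

/-- **One LYM step for a family upward closed inside `N`.**  For all `D, k`:
`#(level k) · (#N − k) ≤ #(level (k+1)) · (k + 1 − #D)` — double count the pairs `S ⊂ T` (`S` at level `k`, `T` at
level `k+1`); every `S` has exactly `#N − k` such `T = insert x S` (`x ∈ N ∖ S`, all in `𝒰` by upward closure), every
`T` has at most `k + 1 − #D` such `S = T.erase x` (`x ∈ T ∖ D`). [folklore] -/
theorem card_level_mul_le {𝒰 : Finset (Finset α)} (D : Finset α) {N : Finset α}
    (h𝒰 : ∀ ⦃A B : Finset α⦄, A ∈ 𝒰 → A ⊆ B → B ⊆ N → B ∈ 𝒰) (k : ℕ) :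
    #(level 𝒰 D N k) * (#N - k) ≤ #(level 𝒰 D N (k + 1)) * (k + 1 - #D) := by
  refine card_mul_le_card_mul (fun S T => S ⊆ T) (fun S hS => ?_) (fun T hT => ?_)
  · -- each `S` at level `k` lies below at least `#N - k` members of level `k+1`
    obtain ⟨hS𝒰, hDS, hSN, hSk⟩ := mem_level.1 hS
    have hsub : (N \ S).image (fun x => insert x S) ⊆
        (level 𝒰 D N (k + 1)).bipartiteAbove (fun S T => S ⊆ T) S := by
      intro T hT
      obtain ⟨x, hx, rfl⟩ := mem_image.1 hT
      obtain ⟨hxN, hxS⟩ := mem_sdiff.1 hx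
      refine (mem_bipartiteAbove _).2 ⟨mem_level.2 ⟨?_, ?_, ?_, ?_⟩, subset_insert x S⟩
      · exact h𝒰 hS𝒰 (subset_insert x S) (insert_subset hxN hSN)
      · exact hDS.trans (subset_insert x S)
      · exact insert_subset hxN hSN
      · rw [card_insert_of_notMem hxS, hSk]
    have hinj : Set.InjOn (fun x => insert x S) ↑(N \ S) := by
      intro x hx y hy hxy
      have hxS : x ∉ S := (mem_sdiff.1 (mem_coe.1 hx)).2
      have hxy' : insert x S = insert y S := hxy
      have : x ∈ insert y S := by rw [← hxy']; exact mem_insert_self x S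
      rcases mem_insert.1 this with h | h
      · exact h
      · exact absurd h hxS
    calc #N - k = #(N \ S) := by rw [card_sdiff_of_subset hSN, hSk]
      _ = #((N \ S).image fun x => insert x S) := (card_image_of_injOn hinj).symm
      _ ≤ _ := card_le_card hsub
  · -- each `T` at level `k+1` lies above at most `k + 1 - #D` members of level `k`
    obtain ⟨hT𝒰, hDT, hTN, hTk⟩ := mem_level.1 hT
    have hsub : (level 𝒰 D N k).bipartiteBelow (fun S T => S ⊆ T) T ⊆ (T \ D).image fun x => T.erase x := by
      intro S hS
      obtain ⟨hSl, hST⟩ := (mem_bipartiteBelow _).1 hS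
      obtain ⟨hS𝒰, hDS, hSN, hSk⟩ := mem_level.1 hSl
      have hcard : #(T \ S) = 1 := by rw [card_sdiff_of_subset hST, hTk, hSk]; omega
      obtain ⟨x, hx⟩ := card_eq_one.1 hcard
      have hxmem : x ∈ T \ S := hx ▸ mem_singleton_self x
      have hxD : x ∉ D := fun h => (mem_sdiff.1 hxmem).2 (hDS h)
      refine mem_image.2 ⟨x, mem_sdiff.2 ⟨(mem_sdiff.1 hxmem).1, hxD⟩, ?_⟩
      rw [← sdiff_singleton_eq_erase, ← hx, Finset.sdiff_sdiff_eq_self hST]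
    calc #((level 𝒰 D N k).bipartiteBelow (fun S T => S ⊆ T) T) ≤ #((T \ D).image fun x => T.erase x) :=
          card_le_card hsub
      _ ≤ #(T \ D) := card_image_le
      _ = k + 1 - #D := by rw [card_sdiff_of_subset hDT, hTk]

/-- **LYM for a family upward closed inside a cube, density form.**  With `g = #N − #D` the dimension of the cube
`[D, N]` and levels re-indexed from `D` (`a, b` = number of points above `D`), for `a ≤ b ≤ g`:
`#(level (#D + a)) · C(g, b) ≤ #(level (#D + b)) · C(g, a)`, i.e. `#(level)/C(g,·)` is non-decreasing. [folklore] -/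
theorem card_level_mul_choose_le {𝒰 : Finset (Finset α)} {D N : Finset α}
    (h𝒰 : ∀ ⦃A B : Finset α⦄, A ∈ 𝒰 → A ⊆ B → B ⊆ N → B ∈ 𝒰) (hDN : D ⊆ N) {a b : ℕ} (hab : a ≤ b)
    (hb : b ≤ #N - #D) :
    #(level 𝒰 D N (#D + a)) * (#N - #D).choose b ≤ #(level 𝒰 D N (#D + b)) * (#N - #D).choose a := by
  induction b, hab using Nat.le_induction with
  | base => exact le_rfl
  | succ b hab ih =>
    have hDcard : #D ≤ #N := card_le_card hDN
    set g := #N - #D with hg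
    have ih' := ih (by omega)
    -- one step at level `#D + b`
    have hstep : #(level 𝒰 D N (#D + b)) * (g - b) ≤ #(level 𝒰 D N (#D + (b + 1))) * (b + 1) := by
      have h0 := card_level_mul_le D h𝒰 (#D + b)
      have e1 : #D + b + 1 = #D + (b + 1) := by omega
      have e2 : #D + (b + 1) - #D = b + 1 := by omega
      have e3 : #N - (#D + b) = g - b := by omega
      simp only [e1, e2, e3] at h0
      exact h0
    -- `C(g, b+1) · (b+1) = C(g, b) · (g - b)`
    have hch : g.choose (b + 1) * (b + 1) = g.choose b * (g - b) := Nat.choose_succ_right_eq g b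
    have hpos : 0 < g.choose b := Nat.choose_pos (by omega)
    have key : #(level 𝒰 D N (#D + a)) * g.choose (b + 1) * (g.choose b * (b + 1)) ≤
        #(level 𝒰 D N (#D + (b + 1))) * g.choose a * (g.choose b * (b + 1)) := by
      calc #(level 𝒰 D N (#D + a)) * g.choose (b + 1) * (g.choose b * (b + 1))
          = (#(level 𝒰 D N (#D + a)) * g.choose b) * (g.choose (b + 1) * (b + 1)) := by ring
        _ ≤ (#(level 𝒰 D N (#D + b)) * g.choose a) * (g.choose (b + 1) * (b + 1)) :=
            Nat.mul_le_mul_right _ ih'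
        _ = (#(level 𝒰 D N (#D + b)) * (g - b)) * (g.choose a * g.choose b) := by rw [hch]; ring
        _ ≤ (#(level 𝒰 D N (#D + (b + 1))) * (b + 1)) * (g.choose a * g.choose b) :=
            Nat.mul_le_mul_right _ hstep
        _ = #(level 𝒰 D N (#D + (b + 1))) * g.choose a * (g.choose b * (b + 1)) := by ring
    exact Nat.le_of_mul_le_mul_right key (Nat.mul_pos hpos (Nat.succ_pos b))

/-- **LYM for up-sets at complementary levels of a cube** (the form the certificate programme uses).  For a family
`𝒰` upward closed inside `N`, `D ⊆ N` and `c ≤ j` with `c + j = #N + #D`: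
`#{S ∈ 𝒰 : D ⊆ S ⊆ N, #S = c} ≤ #{S ∈ 𝒰 : D ⊆ S ⊆ N, #S = j}`. [folklore] -/
theorem card_level_le_card_level {𝒰 : Finset (Finset α)} {D N : Finset α}
    (h𝒰 : ∀ ⦃A B : Finset α⦄, A ∈ 𝒰 → A ⊆ B → B ⊆ N → B ∈ 𝒰) (hDN : D ⊆ N) {c j : ℕ} (hcj : c ≤ j)
    (hsum : c + j = #N + #D) :
    #(level 𝒰 D N c) ≤ #(level 𝒰 D N j) := by
  have hDcard : #D ≤ #N := card_le_card hDN
  by_cases hc : #D ≤ c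
  · obtain ⟨a, rfl⟩ : ∃ a, c = #D + a := ⟨c - #D, by omega⟩
    obtain ⟨b, rfl⟩ : ∃ b, j = #D + b := ⟨j - #D, by omega⟩
    have hab : a ≤ b := by omega
    have hb : b ≤ #N - #D := by omega
    have h := card_level_mul_choose_le h𝒰 hDN hab hb
    have hsymm : (#N - #D).choose b = (#N - #D).choose a := by
      rw [show b = (#N - #D) - a by omega]; exact Nat.choose_symm (by omega)
    rw [hsymm] at h
    exact Nat.le_of_mul_le_mul_right h (Nat.choose_pos (by omega))
  · -- below `#D` the level is empty
    have : level 𝒰 D N c = ∅ := by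
      refine filter_eq_empty_iff.2 fun S _ h => ?_
      have := card_le_card h.1
      omega
    simp [this]

/-- Specialisation to a genuine up-set of the whole lattice (`IsUpperSet`, e.g. on a finite type). [folklore] -/
theorem card_level_le_card_level_of_isUpperSet {𝒰 : Finset (Finset α)} (h𝒰 : IsUpperSet (𝒰 : Set (Finset α)))
    {D N : Finset α} (hDN : D ⊆ N) {c j : ℕ} (hcj : c ≤ j) (hsum : c + j = #N + #D) :
    #(level 𝒰 D N c) ≤ #(level 𝒰 D N j) :=
  card_level_le_card_level (fun _ _ hA hAB _ => h𝒰 hAB hA) hDN hcj hsum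

/-! ### Pair-count (coefficientwise) forms -/

/-- The pairs `(P, S)` with `P ∩ S = D`, `P ∪ S = N`, `S ∈ 𝒰`, and size constraints `pP` on `#P`, `pS` on `#S` — the
combinatorial content of the coefficient of `r^μ` (`μ = 1_N + 1_D`) in `GF({P : pP #P})·GF({S ∈ 𝒰 : pS #S})`.
[this work] -/
def pairs (𝒰 : Finset (Finset α)) (D N : Finset α) (pP pS : ℕ → Prop) [DecidablePred pP] [DecidablePred pS] :
    Finset (Finset α × Finset α) :=
  (N.powerset ×ˢ 𝒰).filter fun PS => PS.1 ∩ PS.2 = D ∧ PS.1 ∪ PS.2 = N ∧ pP #PS.1 ∧ pS #PS.2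

omit [DecidableEq α] in
/-- Membership in `pairs`. [this work] -/
theorem mem_pairs [DecidableEq α] {𝒰 : Finset (Finset α)} {D N : Finset α} {pP pS : ℕ → Prop} [DecidablePred pP]
    [DecidablePred pS] {PS : Finset α × Finset α} :
    PS ∈ pairs 𝒰 D N pP pS ↔ PS.2 ∈ 𝒰 ∧ PS.1 ∩ PS.2 = D ∧ PS.1 ∪ PS.2 = N ∧ pP #PS.1 ∧ pS #PS.2 := by
  constructor
  · intro h
    obtain ⟨h1, h2⟩ := mem_filter.1 h
    exact ⟨(mem_product.1 h1).2, h2⟩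
  · rintro ⟨hS, hI, hU, hP, hS'⟩
    refine mem_filter.2 ⟨mem_product.2 ⟨mem_powerset.2 ?_, hS⟩, hI, hU, hP, hS'⟩
    rw [← hU]; exact subset_union_left

/-- In a pair `(P, S)` with `P ∩ S = D` and `P ∪ S = N`, the first component is determined by the second:
`P = D ∪ (N \ S)`. [this work] -/
theorem fst_eq_of_inter_union {P S D N : Finset α} (hI : P ∩ S = D) (hU : P ∪ S = N) : P = D ∪ (N \ S) := by
  ext x
  simp only [mem_union, mem_sdiff]
  constructor
  · intro hx
    by_cases hxS : x ∈ S
    · left; rw [← hI]; exact mem_inter.2 ⟨hx, hxS⟩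
    · right; exact ⟨hU ▸ mem_union_left S hx, hxS⟩
  · rintro (hx | ⟨hxN, hxS⟩)
    · exact (mem_inter.1 (hI ▸ hx)).1
    · rcases mem_union.1 (hU ▸ hxN) with h | h
      · exact h
      · exact absurd h hxS

/-- Size bookkeeping: `P ∩ S = D`, `P ∪ S = N` force `#P + #S = #N + #D`. [this work] -/
theorem card_add_card_of_inter_union {P S D N : Finset α} (hI : P ∩ S = D) (hU : P ∪ S = N) :
    #P + #S = #N + #D := by
  rw [← hU, ← hI]; exact (card_union_add_card_inter P S).symm

/-- The pairs with `#P = p₀` and `#S = s₀` are counted by the level `s₀` of `𝒰` in the cube `[D, N]`, provided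
`p₀ + s₀ = #N + #D` (otherwise there are none): `(P, S) ↦ S` is a bijection onto the level. [this work] -/
theorem card_pairs_eq_card_level {𝒰 : Finset (Finset α)} {D N : Finset α} (hDN : D ⊆ N) {p₀ s₀ : ℕ}
    (hsum : p₀ + s₀ = #N + #D) :
    #(pairs 𝒰 D N (· = p₀) (· = s₀)) = #(level 𝒰 D N s₀) := by
  refine card_bij (fun PS _ => PS.2) (fun PS hPS => ?_) (fun PS hPS QT hQT h => ?_) (fun S hS => ?_)
  · obtain ⟨hS, hI, hU, hP, hS'⟩ := mem_pairs.1 hPS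
    refine mem_level.2 ⟨hS, ?_, ?_, hS'⟩
    · rw [← hI]; exact inter_subset_right
    · rw [← hU]; exact subset_union_right
  · obtain ⟨_, hI, hU, _, _⟩ := mem_pairs.1 hPS
    obtain ⟨_, hI', hU', _, _⟩ := mem_pairs.1 hQT
    have h1 : PS.1 = QT.1 := by
      rw [fst_eq_of_inter_union hI hU, fst_eq_of_inter_union hI' hU', h]
    exact Prod.ext h1 h
  · obtain ⟨hS𝒰, hDS, hSN, hSk⟩ := mem_level.1 hS
    refine ⟨(D ∪ (N \ S), S), mem_pairs.2 ⟨hS𝒰, ?_, ?_, ?_, hSk⟩, rfl⟩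
    · -- intersection
      ext x; simp only [mem_inter, mem_union, mem_sdiff]
      constructor
      · rintro ⟨hx | ⟨_, hxS⟩, hxS'⟩
        · exact hx
        · exact absurd hxS' hxS
      · intro hx; exact ⟨Or.inl hx, hDS hx⟩
    · -- union
      ext x; simp only [mem_union, mem_sdiff]
      constructor
      · rintro ((hx | ⟨hxN, _⟩) | hx)
        · exact hDN hx
        · exact hxN
        · exact hSN hx
      · intro hxN
        by_cases hxS : x ∈ S
        · exact Or.inr hxS
        · exact Or.inl (Or.inr ⟨hxN, hxS⟩)
    · -- size of the first component
      simp only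
      have hdisj : Disjoint D (N \ S) := disjoint_left.2 fun x hxD hx => (mem_sdiff.1 hx).2 (hDS hxD)
      rw [card_union_of_disjoint hdisj, card_sdiff_of_subset hSN, hSk]
      have := card_le_card hSN; have := card_le_card hDS; omega

/-- If `P ∩ S = D` and `P ∪ S = N` for some pair then `D ⊆ N`. [this work] -/
theorem subset_of_pairs_nonempty {𝒰 : Finset (Finset α)} {D N : Finset α} {pP pS : ℕ → Prop} [DecidablePred pP]
    [DecidablePred pS] (h : (pairs 𝒰 D N pP pS).Nonempty) : D ⊆ N := by
  obtain ⟨PS, hPS⟩ := h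
  obtain ⟨_, hI, hU, _, _⟩ := mem_pairs.1 hPS
  rw [← hI, ← hU]; exact inter_subset_left.trans subset_union_left

/-- **Weighted LYM for up-sets, coefficientwise** (memo Lemma 1.1: `e_c·𝒰_j − e_j·𝒰_c ∈ ℕ[r]` for an up-set `𝒰` and
`c ≤ j`).  At every profile (`D` = doubled points, `N` = support) the number of pairs `(P, S)` with `#P = j`, `S ∈ 𝒰`,
`#S = c` is at most the number of pairs with `#P = c`, `S ∈ 𝒰`, `#S = j`; `𝒰` need only be upward closed inside `N`.
[this work] -/
theorem weightedLYM_pairs {𝒰 : Finset (Finset α)} (D N : Finset α)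
    (h𝒰 : ∀ ⦃A B : Finset α⦄, A ∈ 𝒰 → A ⊆ B → B ⊆ N → B ∈ 𝒰) {c j : ℕ} (hcj : c ≤ j) :
    #(pairs 𝒰 D N (· = j) (· = c)) ≤ #(pairs 𝒰 D N (· = c) (· = j)) := by
  rcases (pairs 𝒰 D N (· = j) (· = c)).eq_empty_or_nonempty with h0 | hne
  · rw [h0]; exact Nat.zero_le _
  have hDN : D ⊆ N := subset_of_pairs_nonempty hne
  -- the size constraint is automatic for nonempty pair sets
  obtain ⟨PS, hPS⟩ := hne
  obtain ⟨_, hI, hU, hP, hS⟩ := mem_pairs.1 hPS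
  have hsum : j + c = #N + #D := by rw [← hP, ← hS]; exact card_add_card_of_inter_union hI hU
  rw [card_pairs_eq_card_level hDN hsum, card_pairs_eq_card_level hDN (by omega : c + j = #N + #D)]
  exact card_level_le_card_level h𝒰 hDN hcj (by omega)

/-- `weightedLYM_pairs` for a genuine up-set (`IsUpperSet`). [this work] -/
theorem weightedLYM_pairs_of_isUpperSet {𝒰 : Finset (Finset α)} (h𝒰 : IsUpperSet (𝒰 : Set (Finset α)))
    (D N : Finset α) {c j : ℕ} (hcj : c ≤ j) :
    #(pairs 𝒰 D N (· = j) (· = c)) ≤ #(pairs 𝒰 D N (· = c) (· = j)) :=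
  weightedLYM_pairs D N (fun _ _ hA hAB _ => h𝒰 hAB hA) hcj

/-- **The flag lemma, coefficientwise** (memo Lemma 1.2 (M2): `Θ·t̄_K − D·ε̄_K ∈ ℕ[r]`, with `𝒰` the up-set of
non-faces of a simplicial complex `K`, `ε̄_K = 𝒰_2` its non-edges, `t̄_K = 𝒰_{≥3}`, `Θ` = sets of size `≤ 2`, `D` = sets
of size `≥ 3`).  For any family `𝒰` upward closed inside `N`: at every profile the number of pairs `(P, S)` with
`#P ≥ 3`, `S ∈ 𝒰`, `#S = 2` is at most the number of pairs with `#P ≤ 2`, `S ∈ 𝒰`, `#S ≥ 3`. [this work] -/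
theorem flagLemma_pairs {𝒰 : Finset (Finset α)} (D N : Finset α)
    (h𝒰 : ∀ ⦃A B : Finset α⦄, A ∈ 𝒰 → A ⊆ B → B ⊆ N → B ∈ 𝒰) :
    #(pairs 𝒰 D N (3 ≤ ·) (· = 2)) ≤ #(pairs 𝒰 D N (· ≤ 2) (3 ≤ ·)) := by
  rcases (pairs 𝒰 D N (3 ≤ ·) (· = 2)).eq_empty_or_nonempty with h0 | hne
  · rw [h0]; exact Nat.zero_le _
  have hDN : D ⊆ N := subset_of_pairs_nonempty hne
  obtain ⟨PS, hPS⟩ := hne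
  obtain ⟨_, hI, hU, hP, hS⟩ := mem_pairs.1 hPS
  have hsum := card_add_card_of_inter_union hI hU
  set j := #N + #D - 2 with hj
  have hj3 : 3 ≤ j := by omega
  -- all pairs on the left have `#P = j`
  have hL : pairs 𝒰 D N (3 ≤ ·) (· = 2) = pairs 𝒰 D N (· = j) (· = 2) := by
    ext QT
    simp only [mem_pairs]
    constructor
    · rintro ⟨h1, h2, h3, _, h5⟩
      exact ⟨h1, h2, h3, by have := card_add_card_of_inter_union h2 h3; omega, h5⟩
    · rintro ⟨h1, h2, h3, h4, h5⟩
      exact ⟨h1, h2, h3, by omega, h5⟩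
  -- the pairs with `#P = 2`, `#S = j` are among those on the right
  have hR : pairs 𝒰 D N (· = 2) (· = j) ⊆ pairs 𝒰 D N (· ≤ 2) (3 ≤ ·) := by
    intro QT hQT
    obtain ⟨h1, h2, h3, h4, h5⟩ := mem_pairs.1 hQT
    exact mem_pairs.2 ⟨h1, h2, h3, by omega, by omega⟩
  rw [hL]
  exact (weightedLYM_pairs D N h𝒰 (by omega : 2 ≤ j)).trans (card_le_card hR)

/-- `flagLemma_pairs` for a genuine up-set (`IsUpperSet`). [this work] -/
theorem flagLemma_pairs_of_isUpperSet {𝒰 : Finset (Finset α)} (h𝒰 : IsUpperSet (𝒰 : Set (Finset α)))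
    (D N : Finset α) : #(pairs 𝒰 D N (3 ≤ ·) (· = 2)) ≤ #(pairs 𝒰 D N (· ≤ 2) (3 ≤ ·)) :=
  flagLemma_pairs D N fun _ _ hA hAB _ => h𝒰 hAB hA

end Summit.CriticalPhenomena.PercolationContinuityZ3.Theorems.SahiCTCWeightedLYM
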